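import Summits.CriticalPhenomena.SAWScalingLimit.Theorems.SAWDevelopingMapObservableToSLECanonicalTransferLimit
import Literature.Probability.Percolation.SitePaths
import HarnessLib

/-!
# Crux `SAWDevelopingMap.ObservableToSLE` (stmt-CriticalPhenomena-10472), line
`floor-ratio-restriction-bootstrap`, stub `stub_canonicalTransfer`: small admissibility clauses of
the inner discretisation (M1)

Landing target:
`Summits/CriticalPhenomena/SAWScalingLimit/Theorems/SAWDevelopingMapObservableToSLECanonicalTransferAdmissibleBits.lean`
(`--supports stmt-CriticalPhenomena-10472`).

Some of the admissibility clauses required of the inner families `Λ' δ ⊆ Λ δ` of the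
discretisation input (M1) of `canonicalTransfer_ofDiscretisation` are bookkeeping, settled here
once and for all:

* `fill_mono` — fills (`…CanonicalTransferFill.lean`) are monotone in the filled set, whence
  `Λ' δ ⊆ Λ δ` for the fills of nested components;
* `mem_hexDomainBoundary_of_adj` — the floor mid-edge `{v, u}` (`v ∈ Λ`, `u ∉ Λ`, `v ∼ u`) is a
  boundary mid-edge of `Λ`;
* `exists_walk_of_induce` — walks of the induced graph are walks of `ℍ` inside `Λ` (the clause
  `Nonempty (HexMidEdgeSAW …)` for connected `Λ` is ALREADY in the tree:
  `nonempty_hexMidEdgeSAW_of_preconnected`, `…RestrictionCocycleHelpersLattice.lean`);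
* `tendsto_smul_hexMidpoint` = registered sub-goal `stub_canonicalTransfer_midpoint` — if
  `δ c_{a δ} → p` and `u δ ∼ a δ` eventually, the rescaled mid-edge `δ · mid {a δ, u δ} → p`.
-/

noncomputable section

open scoped Topology
open Filter Set Metric
open Literature.Probability.LatticeModels (HexVertex hexGraph hexCenter)
open Literature.Probability.RandomPlanarGeometry
open Literature.Probability.RandomPlanarGeometry.SAW
open Literature.Probability.Percolation (PathIn)

namespace Summit.CriticalPhenomena.SAWScalingLimit.Theorems.ObservableToSLE.FloorRatio

/-- **Fills are monotone**: if `G' ⊆ G` then a vertex that cannot reach the far set `F` avoiding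
`G'` cannot reach it avoiding `G` (`fill G' ⊆ fill G`). [folklore] -/
theorem fill_mono {G G' F : Set HexVertex} (h : G' ⊆ G) {z : HexVertex}
    (hz : ¬ ∃ w ∈ F, PathIn hexGraph G'ᶜ z w) : ¬ ∃ w ∈ F, PathIn hexGraph Gᶜ z w :=
  fun ⟨w, hw, hzw⟩ => hz ⟨w, hw, hzw.mono (compl_subset_compl.2 h)⟩

/-- The mid-edge `{v, u}` with `v ∈ Λ`, `u ∉ Λ`, `v ∼ u` is a boundary mid-edge of `Λ` (in both
orientations of the unordered pair). [cite: DuminilCopinSmirnov2012, §2 (domains)] -/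
theorem mem_hexDomainBoundary_of_adj {Λ : Finset HexVertex} {v u : HexVertex} (hv : v ∈ Λ)
    (hu : u ∉ Λ) (h : hexGraph.Adj v u) :
    s(v, u) ∈ hexDomainBoundary Λ ∧ s(u, v) ∈ hexDomainBoundary Λ :=
  ⟨⟨(SimpleGraph.mem_edgeSet hexGraph).2 h, u, v, Sym2.eq_swap, hv, hu⟩,
    ⟨(SimpleGraph.mem_edgeSet hexGraph).2 h.symm, u, v, rfl, hv, hu⟩⟩

/-- A walk of an induced subgraph is a walk of the graph staying in the inducing set. [folklore] -/
theorem exists_walk_of_induce {V : Type*} {G : SimpleGraph V} {s : Set V} :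
    ∀ {x y : s} (_ : (G.induce s).Walk x y), ∃ q : G.Walk x.1 y.1, ∀ w ∈ q.support, w ∈ s
  | _, _, SimpleGraph.Walk.nil => ⟨SimpleGraph.Walk.nil, fun w hw => by
      rw [SimpleGraph.Walk.support_nil, List.mem_singleton] at hw
      exact hw ▸ Subtype.property _⟩
  | x, _, SimpleGraph.Walk.cons h p => by
      obtain ⟨q, hq⟩ := exists_walk_of_induce p
      refine ⟨SimpleGraph.Walk.cons (SimpleGraph.induce_adj.1 h) q, fun w hw => ?_⟩
      rw [SimpleGraph.Walk.support_cons, List.mem_cons] at hw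
      rcases hw with rfl | hw
      · exact x.2
      · exact hq w hw

/-- **Rescaled floor mid-edges converge with their vertex** (named form of the registered sub-goal
`stub_canonicalTransfer_midpoint`): if `δ c_{a δ} → p` as `δ → 0⁺` and `u δ` is eventually a
honeycomb neighbour of `a δ`, then `δ · mid {a δ, u δ} → p`. [folklore] -/
theorem tendsto_smul_hexMidpoint {p : ℂ} {a u : ℝ → HexVertex}
    (ha : Tendsto (fun δ : ℝ => (δ : ℂ) * hexCenter (a δ)) (𝓝[>] 0) (𝓝 p))
    (hu : ∀ᶠ δ : ℝ in 𝓝[>] 0, hexGraph.Adj (a δ) (u δ)) :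
    Tendsto (fun δ : ℝ => (δ : ℂ) * hexMidpoint s(a δ, u δ)) (𝓝[>] 0) (𝓝 p) := by
  -- the neighbour converges too
  have hu' : Tendsto (fun δ : ℝ => (δ : ℂ) * hexCenter (u δ)) (𝓝[>] 0) (𝓝 p) := by
    rw [Metric.tendsto_nhds] at ha ⊢
    intro ε hε
    have hδ : ∀ᶠ δ : ℝ in 𝓝[>] 0, δ ∈ Ioo 0 (ε / 2) := Ioo_mem_nhdsGT (half_pos hε)
    filter_upwards [ha (ε / 2) (half_pos hε), hu, hδ] with δ h1 h2 h3
    calc dist ((δ : ℂ) * hexCenter (u δ)) p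
        ≤ dist ((δ : ℂ) * hexCenter (u δ)) ((δ : ℂ) * hexCenter (a δ)) +
            dist ((δ : ℂ) * hexCenter (a δ)) p := dist_triangle _ _ _
      _ < δ + ε / 2 := add_lt_add_of_le_of_lt (dist_smul_hexCenter_le_of_adj h3.1.le h2) h1
      _ < ε := by linarith [h3.2]
  have h := (ha.add hu').const_mul ((2 : ℂ)⁻¹)
  rw [show (2 : ℂ)⁻¹ * (p + p) = p by ring] at h
  refine h.congr fun δ => ?_
  rw [hexMidpoint_mk]
  ring

/-- **Registered sub-goal `stub_canonicalTransfer_midpoint`** (crux item stmt-CriticalPhenomena-10472,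
line `floor-ratio-restriction-bootstrap`, stub `stub_canonicalTransfer`): rescaled floor mid-edges
converge with their vertex, registry form of `tendsto_smul_hexMidpoint`. [folklore] -/
theorem stub_canonicalTransfer_midpoint :
    ∀ (p : ℂ) (a u : ℝ → HexVertex),
    Tendsto (fun δ : ℝ => (δ : ℂ) * hexCenter (a δ)) (𝓝[>] 0) (𝓝 p) →
    (∀ᶠ δ : ℝ in 𝓝[>] 0, hexGraph.Adj (a δ) (u δ)) →
    Tendsto (fun δ : ℝ => (δ : ℂ) * hexMidpoint s(a δ, u δ)) (𝓝[>] 0) (𝓝 p) :=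
  fun _ _ _ ha hu => tendsto_smul_hexMidpoint ha hu

end Summit.CriticalPhenomena.SAWScalingLimit.Theorems.ObservableToSLE.FloorRatio

end
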